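import Literature.Barriers.ABC.BakerMethodBoundsStewartYuProofs
import Literature.NumberTheory.DiophantineGeometry.AbcWave0QualityFormProofs

/-!
# Face clearing: `log c ≤ κ (log rad)⁵` on the power-of-two faces of abc triples on few primes

Helper (`--supports`) for the crux `Summit.ABC.ABC.Theses.RibetTakahashiSplit.FewPrimeValuationProduct`
(stmt-ABC-1563), line `matveev-face-clearing`, stub `stub_faceBound`.

**Statement (`stub_faceBound`).** If Pasten's approximation bound
`Literature.NumberTheory.DiophantineGeometry.Dioph.PastenApproximationBound K` holds for some
`K ≥ 1` (lower bounds for linear forms in complex and `p`-adic logarithms over `ℚ`, Matveev + Yu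
in the form of H. Pasten, Invent. Math. 236 (2024), Theorem 2.1), then there are `A : ℕ` and
`κ : ℝ` such that every abc triple `a + b = c` with `ω(abc) ≤ 4`, one of whose members is a power
of two (`1 = 2⁰` included), satisfies `log c ≤ κ · (log rad(abc))^A`. We prove it with `A = 5` and
`κ = 448 K⁵ (log(28 K⁵) + 4)`.

**Proof.** Let `w ∈ {a, b, c}` be the power-of-two member and `u, v` the other two members. The
Stewart–Yu route through `w` (`Literature.Barriers.ABC.log_lt_route_a/_b/_c`: the archimedean
clause of the approximation bound and its `p`-adic clauses at the primes of `w`) gives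
`log c < Θ_{uv} · Y · (1 + 3 ∑_{p ∣ w} p)` with `Y = log max{e, 2 log c}` and
`Θ_{uv} = theta K u v 0 = K^{ω(uv)+1} ∏_{p ∣ uv} log p` (`theta_zero_eq`). On the face
`∑_{p ∣ w} p ≤ 2`, and `ω(uv) ≤ ω(abc) ≤ 4`, `log p ≤ log rad(abc)` for `p ∣ uv`, so
`log c ≤ 7 K⁵ Λ⁴ · Y` with `Λ = max(1, log rad(abc))`. The self-improvement
`y ≤ M log max{e, 2y} ⟹ y ≤ 2M log(4M)` (`Literature.Barriers.ABC.le_of_le_mul_log_max`) and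
`log Λ ≤ Λ ≤ 2 log rad(abc)` finish. The route through `c` needs `ab > 1`; when `ab = 1` the
member `a = 1 = 2⁰` is itself a power of two and the route through `a` applies, so no separate
treatment of the triple `1 + 1 = 2` is needed.

All ingredients are proved in the tree (`BakerMethodBoundsThreeRoutesProofs`,
`BakerMethodBoundsStewartYuProofs`, `PastenSubexp*`); the only input is the hypothesis
`PastenApproximationBound K`, taken explicitly (it is the neighbouring stub `stub_lflInput` of the
line, one line from the named fact `Dioph.evertseGyory_thm_4_2_1_rat`).
-/

-- `Summit.ABC.ABC` is the mandated summit-side namespace (CONVENTIONS §2); the duplicate is deliberate.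
set_option linter.dupNamespace false

namespace Summit.ABC.ABC.Theorems.FewPrimeValuationProduct

open Finset Real
open Literature.NumberTheory.DiophantineGeometry
open Literature.NumberTheory.DiophantineGeometry.Dioph
open Literature.NumberTheory.DiophantineGeometry.Pasten
open Literature.Barriers.ABC

/-! ## The three numerical ingredients -/

/-- **The route factor on a face.** For a power of two `w = 2^j` (so `w.primeFactors ⊆ {2}`,
empty when `j = 0`): `1 + 3 ∑_{p ∣ w} p ≤ 7`. `[folklore]` -/
theorem faceBound_routeFactor_le {w j : ℕ} (hw : w = 2 ^ j) :
    (1 : ℝ) + 3 * ∑ p ∈ w.primeFactors, (p : ℝ) ≤ 7 := by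
  have hsub : w.primeFactors ⊆ {2} := by
    intro p hp
    have hp' := Nat.prime_of_mem_primeFactors hp
    have hpw := Nat.dvd_of_mem_primeFactors hp
    rw [hw] at hpw
    rw [Finset.mem_singleton]
    exact (Nat.prime_dvd_prime_iff_eq hp' Nat.prime_two).mp (hp'.dvd_of_dvd_pow hpw)
  have hsum : ∑ p ∈ w.primeFactors, (p : ℝ) ≤ ∑ p ∈ ({2} : Finset ℕ), (p : ℝ) :=
    Finset.sum_le_sum_of_subset_of_nonneg hsub fun p _ _ => Nat.cast_nonneg p
  rw [Finset.sum_singleton] at hsum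
  push_cast at hsum
  linarith

/-- **Pasten's `Θ` on few primes.** For `K ≥ 1`, coprime non-zero `u, v` with `uv ∣ abc ≠ 0`
and `ω(abc) ≤ 4`: `theta K u v 0 ≤ K⁵ · max(1, log rad(abc))⁴`
(from `theta K u v 0 = K^{ω(uv)+1} ∏_{p ∣ uv} log p`, `ω(uv) ≤ 4` and `p ≤ rad(abc)` for
`p ∣ uv`). `[folklore]` -/
theorem faceBound_theta_le {K : ℝ} (hK : 1 ≤ K) {a b c u v : ℕ} (h0 : a * b * c ≠ 0)
    (hu : u ≠ 0) (hv : v ≠ 0) (huv : u.Coprime v) (hdvd : u * v ∣ a * b * c)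
    (hcard : (a * b * c).primeFactors.card ≤ 4) :
    theta K u v 0 ≤ K ^ 5 * max 1 (Real.log (rad a b c : ℕ)) ^ 4 := by
  set Λ : ℝ := max 1 (Real.log (rad a b c : ℕ)) with hΛ
  have hΛ1 : 1 ≤ Λ := le_max_left _ _
  rw [theta_zero_eq K hu hv huv]
  have hsub : (u * v).primeFactors ⊆ (a * b * c).primeFactors := Nat.primeFactors_mono hdvd h0
  have hc4 : (u * v).primeFactors.card ≤ 4 := (Finset.card_le_card hsub).trans hcard
  have hKpow : K ^ ((u * v).primeFactors.card + 1) ≤ K ^ 5 :=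
    pow_le_pow_right₀ hK (by omega)
  have hlog : ∀ p ∈ (u * v).primeFactors, Real.log (p : ℝ) ≤ Λ := by
    intro p hp
    have hp' := Nat.prime_of_mem_primeFactors hp
    have hpR : (p : ℝ) ≤ (rad a b c : ℝ) := by
      exact_mod_cast prime_le_rad hp' ((Nat.dvd_of_mem_primeFactors hp).trans hdvd) h0
    have hp0 : (0 : ℝ) < p := by exact_mod_cast hp'.pos
    exact (Real.log_le_log hp0 hpR).trans (le_max_right _ _)
  have hlog0 : ∀ p ∈ (u * v).primeFactors, 0 ≤ Real.log (p : ℝ) := fun p hp =>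
    Real.log_nonneg (by exact_mod_cast (Nat.prime_of_mem_primeFactors hp).one_lt.le)
  have hprod : ∏ p ∈ (u * v).primeFactors, Real.log (p : ℝ) ≤ Λ ^ 4 :=
    calc ∏ p ∈ (u * v).primeFactors, Real.log (p : ℝ)
        ≤ ∏ _p ∈ (u * v).primeFactors, Λ := Finset.prod_le_prod hlog0 hlog
      _ = Λ ^ (u * v).primeFactors.card := Finset.prod_const Λ
      _ ≤ Λ ^ 4 := pow_le_pow_right₀ hΛ1 hc4
  have hprod0 : 0 ≤ ∏ p ∈ (u * v).primeFactors, Real.log (p : ℝ) := Finset.prod_nonneg hlog0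
  have hK0 : 0 ≤ K := zero_le_one.trans hK
  exact mul_le_mul hKpow hprod hprod0 (by positivity)

/-- **The analytic endgame.** If `K ≥ 1`, `L ≥ log 2` and
`y ≤ 7 K⁵ · max(1, L)⁴ · log max{e, 2y}`, then `y ≤ 448 K⁵ (log(28 K⁵) + 4) · L⁵`:
self-improvement (`le_of_le_mul_log_max`) with `M = 7 K⁵ Λ⁴`, `Λ = max(1, L)`, then
`log(4M) = log(28 K⁵) + 4 log Λ ≤ (log(28 K⁵) + 4) Λ` and `Λ ≤ 2L`. `[folklore]` -/
theorem faceBound_analysis {K L y : ℝ} (hK : 1 ≤ K) (hL : Real.log 2 ≤ L)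
    (h : y ≤ 7 * K ^ 5 * max 1 L ^ 4 * Real.log (max (Real.exp 1) (2 * y))) :
    y ≤ 448 * K ^ 5 * (Real.log (28 * K ^ 5) + 4) * L ^ 5 := by
  set Λ : ℝ := max 1 L with hΛ
  set c₀ : ℝ := Real.log (28 * K ^ 5) with hc₀
  set M : ℝ := 7 * K ^ 5 * Λ ^ 4 with hM
  have hΛ1 : 1 ≤ Λ := le_max_left _ _
  have hΛ0 : 0 < Λ := by linarith
  have hK0 : 0 < K := by linarith
  have hK5 : 1 ≤ K ^ 5 := one_le_pow₀ hK
  have hΛ4 : 1 ≤ Λ ^ 4 := one_le_pow₀ hΛ1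
  have hM1 : 1 ≤ M :=
    calc (1 : ℝ) ≤ 7 * 1 * 1 := by norm_num
      _ ≤ 7 * K ^ 5 * Λ ^ 4 :=
          mul_le_mul (mul_le_mul_of_nonneg_left hK5 (by norm_num)) hΛ4 zero_le_one (by positivity)
  have h2 : y ≤ 2 * M * Real.log (4 * M) := le_of_le_mul_log_max hM1 h
  have hc₀0 : 0 ≤ c₀ := Real.log_nonneg (by nlinarith)
  have hlog4M : Real.log (4 * M) ≤ (c₀ + 4) * Λ := by
    have h4M : 4 * M = (28 * K ^ 5) * Λ ^ 4 := by rw [hM]; ring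
    have hexp : Real.log (4 * M) = c₀ + 4 * Real.log Λ := by
      rw [h4M, Real.log_mul (by positivity) (by positivity), Real.log_pow, hc₀]
      push_cast
      ring
    have hlogΛ : Real.log Λ ≤ Λ := Real.log_le_self hΛ0.le
    have hc₀Λ : c₀ ≤ c₀ * Λ := le_mul_of_one_le_right hc₀0 hΛ1
    rw [hexp]
    nlinarith
  have hlog2 : (1 / 2 : ℝ) ≤ Real.log 2 := by have := Real.log_two_gt_d9; linarith
  have hL0 : 0 ≤ L := by linarith
  have hΛL : Λ ≤ 2 * L := max_le (by linarith) (by linarith)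
  have hM0 : 0 ≤ M := by linarith
  calc y ≤ 2 * M * Real.log (4 * M) := h2
    _ ≤ 2 * M * ((c₀ + 4) * Λ) := mul_le_mul_of_nonneg_left hlog4M (by positivity)
    _ = 14 * K ^ 5 * (c₀ + 4) * Λ ^ 5 := by rw [hM]; ring
    _ ≤ 14 * K ^ 5 * (c₀ + 4) * (2 * L) ^ 5 :=
        mul_le_mul_of_nonneg_left (pow_le_pow_left₀ hΛ0.le hΛL 5) (by positivity)
    _ = 448 * K ^ 5 * (c₀ + 4) * L ^ 5 := by ring

/-! ## The stub -/

/-- **Face clearing (stub `stub_faceBound` of line `matveev-face-clearing` for the crux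
`FewPrimeValuationProduct`, stmt-ABC-1563).** If `PastenApproximationBound K` holds for some
`K ≥ 1` (Matveev + Yu over `ℚ` in Pasten's form), then there are `A : ℕ`, `κ : ℝ` with
`log c ≤ κ · (log rad(abc))^A` for every abc triple `a + b = c` with `ω(abc) ≤ 4` one of whose
members is a power of two (`1 = 2⁰` included); in fact `A = 5` and
`κ = 448 K⁵ (log(28 K⁵) + 4)`. Proof: the Stewart–Yu route through the power-of-two member
(`log_lt_route_a/_b/_c`), `faceBound_routeFactor_le`, `faceBound_theta_le`,
`faceBound_analysis`; the degenerate triple `1 + 1 = 2` goes through the member `a = 1 = 2⁰`.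
`[folklore]` (bookkeeping on [Stewart–Yu 2001, §3] as reconstructed in
`Literature.Barriers.ABC.BakerMethodBoundsThreeRoutesProofs`). -/
theorem stub_faceBound :
    (∃ K : ℝ, 1 ≤ K ∧ Literature.NumberTheory.DiophantineGeometry.Dioph.PastenApproximationBound K) →
    ∃ (A : ℕ) (κ : ℝ), ∀ a b c : ℕ, Literature.NumberTheory.DiophantineGeometry.IsABCTriple a b c →
      (a * b * c).primeFactors.card ≤ 4 →
      ((∃ j : ℕ, a = 2 ^ j) ∨ (∃ j : ℕ, b = 2 ^ j) ∨ (∃ j : ℕ, c = 2 ^ j)) →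
      Real.log c ≤ κ * Real.log (Literature.NumberTheory.DiophantineGeometry.rad a b c : ℝ) ^ A := by
  rintro ⟨K, hK, hP⟩
  refine ⟨5, 448 * K ^ 5 * (Real.log (28 * K ^ 5) + 4), fun a b c h hcard hface => ?_⟩
  obtain ⟨ha, hb, habc, hcop⟩ := id h
  have hc : c ≠ 0 := by omega
  have h0 : a * b * c ≠ 0 := by positivity
  -- one route bound: a power-of-two member `w` and the complementary coprime pair `u, v`
  obtain ⟨u, v, w, hu, hv, huv, hdvd, ⟨j, hw⟩, hlt⟩ :
      ∃ u v w : ℕ, u ≠ 0 ∧ v ≠ 0 ∧ u.Coprime v ∧ u * v ∣ a * b * c ∧ (∃ j : ℕ, w = 2 ^ j) ∧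
        Real.log c < theta K u v 0 * Real.log (max (Real.exp 1) (2 * Real.log c)) *
          (1 + 3 * ∑ p ∈ w.primeFactors, (p : ℝ)) := by
    by_cases ha2 : ∃ j : ℕ, a = 2 ^ j
    · exact ⟨b, c, a, hb.ne', hc, coprime_right_of_isABCTriple h, Dvd.intro_left a (by ring), ha2,
        log_lt_route_a hK hP h⟩
    rcases hface with ha2' | hb2 | hc2
    · exact absurd ha2' ha2
    · exact ⟨a, c, b, ha.ne', hc, coprime_left_of_isABCTriple h, Dvd.intro b (by ring), hb2,
        log_lt_route_b hK hP h⟩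
    · have ha1 : a ≠ 1 := fun h1 => ha2 ⟨0, by rw [h1, pow_zero]⟩
      have h1 : 1 < a * b := by
        have h2a : 2 ≤ a := by omega
        calc 1 < 2 := by norm_num
          _ ≤ a * b := h2a.trans (Nat.le_mul_of_pos_right a hb)
      exact ⟨a, b, c, ha.ne', hb.ne', hcop, Dvd.intro c rfl, hc2, log_lt_route_c hK hP h h1⟩
  -- sizes
  set L : ℝ := Real.log (rad a b c : ℕ) with hL
  set Y : ℝ := Real.log (max (Real.exp 1) (2 * Real.log c)) with hY
  have hY0 : 0 ≤ Y := zero_le_one.trans (one_le_log_max_exp _)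
  have hK0 : 0 < K := by linarith
  have hΘ := faceBound_theta_le hK h0 hu hv huv hdvd hcard
  have hF := faceBound_routeFactor_le hw
  have hF0 : (0 : ℝ) ≤ 1 + 3 * ∑ p ∈ w.primeFactors, (p : ℝ) := by positivity
  have hbound : Real.log c ≤ 7 * K ^ 5 * max 1 L ^ 4 * Y :=
    calc Real.log c ≤ theta K u v 0 * Y * (1 + 3 * ∑ p ∈ w.primeFactors, (p : ℝ)) := hlt.le
      _ ≤ K ^ 5 * max 1 L ^ 4 * Y * 7 :=
          mul_le_mul (mul_le_mul_of_nonneg_right hΘ hY0) hF hF0 (by positivity)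
      _ = 7 * K ^ 5 * max 1 L ^ 4 * Y := by ring
  have hL2 : Real.log 2 ≤ L := Real.log_le_log two_pos (by exact_mod_cast h.two_le_rad)
  exact faceBound_analysis hK hL2 hbound

end Summit.ABC.ABC.Theorems.FewPrimeValuationProduct
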